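import Summits.BirchSwinnertonDyer.Rank1Residual.WAll.AltClosersGlueX1Slices
import Literature.NumberTheory.EllipticCurves.Rank1Residual.ClassX1Isogeny
import HarnessLib

/-!
# Rung W-ALL of ladder BSD (D-0120) — row 4 (corner X1), rank `0`: ALT-CLOSERS BY NAME in
# Ш-WITNESS CERTIFICATE currency (cell `bsd-wall`, lane (2), seat `bsd-wall-ty-2` g5)

HONEST FRAMING (cell `bsd-wall`, run/shared/lean/pub/bsd-wall/; brief `WALL-BRIEF-v1.md` sha16
b966bf16da27706e §2 «ty-2: ALT-CLOSERS — for each exclusion Prop, the strongest landed or Literature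
statement that closes a sub-case BY NAME»): THEOREMS ONLY — no definition, no named fact, no
published theorem restated, nothing booked. CONDITIONAL closers: every hypothesis is named.

THE CURRENCY (lane-2 twin, at W-ALL SLICE granularity, of seat `bsd-wall-eis` g2's registered line
`shawitness` on crux `MazurMCOnX1RankZero`, item stmt-BirchSwinnertonDyer-19035, 2026-08-27T07:57Z;
pricing memo `pub/bsd-wall/bsd-wall-eis/g2/X1-19035-PRICING-v1.md`). On the rank-`0` X1 leaf (odd
good ANOMALOUS prime `p` with `E[p]` reducible, `L(E,1) ≠ 0`, off the GV-parity quadrant) the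
published record gives ONE inequality, `ord_p #Ш(E) ≤ ord_p #Ш(E)_an` (Kato–Wuthrich: Wuthrich 2014
Prop. 21), and `BSD(E,p)` at the pair is DECIDED by a finite certificate at ONE member `W'` of the
Mazur (isogeny) class, through two tree levers of `Literature/…/Rank1Residual/ClassX1Isogeny.lean`:
* the UNIT certificate `p ∤ #Ш(W')_an` (`X1.bsdp_of_shaAn_unit_of_isIsogenous'`; Wuthrich Prop. 21
  for `W'` + Cassels' isogeny invariance), or
* the WITNESS certificate `ord_p #Ш(W')_an ≤ 2` plus ONE non-zero element of `Ш(W')` killed by `p`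
  (`X1.bsdp_of_exists_torsion_of_isIsogenous'`; Kato–Wuthrich + Cassels–Tate alternation `#Ш = □` +
  Cassels' isogeny invariance).
The two levers are made exhaustive by the MIN-DIGIT LAW (`hmin`: every rank-`0` X1 class has a member
with `0 ≤ ord_p #Ш_an ≤ 2`; data of record: 10 143 / 10 143 Cremona rank-`0` classes with a good
anomalous reducible odd `p`, `N < 5·10⁵`, min ord `∈ {0 (9 931), 2 (212)}`, none `≥ 3` —
`bsd-wall-eis/g2/mindigit_scan.py` c1c0e6684e61f11a) and the WITNESS AT DIGIT TWO (`hwit`: a member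
with `0 < ord_p #Ш_an ≤ 2` carries `Ш[p] ≠ 0`; per census cell ONE `p`-descent — 146 three-descents +
3 five-descents book the whole A3 residue of record 149/149 —, class-wide `BSD(E,p)`-strength on the
digit-`2` locus). Both hypothesis shapes below are eis g2's stubs `stub_minDigit` /
`stub_witnessAtDigitTwo` VERBATIM (`bsd-wall-eis/g2/line-shawitness.lean` 97aa5d491148d299), so a
booking seat or the line feeds either file by `rfl`. Inputs otherwise: FIVE PUBLISHED named facts BY
NAME — `hCT` Cassels–Tate pairing (bsd.S18), `hW` Wuthrich 2014 Prop. 21, `hGZK`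
Gross–Zagier–Kolyvagin, `hmod` modularity, `hCassels` Cassels 1965 / Milne ADT I.7.3. NO preprint
input and NO `h308` (Keller–Yin IMC2) anywhere on row 4 rank `0` in this currency.

* §0 EXACTNESS of the witness cell: `exists_sha_torsion_of_bsdp_of_padicValRat_pos` — `BSD(E,p)` with
  `0 < ord_p #Ш_an` GIVES a non-zero `p`-torsion element of `Ш` (Cauchy); hence `hwit` follows from
  `X1.RankZero.Statement` and from `WAll` (§3): the witness cell is residue-exact, never stronger
  than the rung; the only input NOT implied by W-ALL is the structural `hmin` (refutable by one class).
* §1 `x1RankZero_bsdp_of_minDigit_of_witness` (per pair) and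
  `x1RankZeroStatement_of_minDigit_of_witness` : PUB⁵ + `hmin` + `hwit` ⇒ `X1.RankZero.Statement`
  (= both rank-`0` slices `WAllCornerX1RankZeroBalanced ∧ WAllCornerX1RankZeroUnbalanced`).
* §2 the UNBALANCED slice from the cells RESTRICTED to the unbalanced locus
  (`wAllCornerX1RankZeroUnbalanced_of_minDigitU_of_witnessU`) — the A3 residue of record is 149/149
  unbalanced-eligible (eis g2 X1-19035-PRICING-v1 (c)).
* §3 `witness_of_x1RankZeroStatement`, `witness_of_wAll` (exactness of the witness cell).
* §4 row 4 and THE REGISTRY with row 4 rank `0` in Ш-witness currency: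
  `wAllCornerX1_of_minDigit_of_witness_of_x1RankOne`, `wAllExclusions_of_sliceLeaves_x1ShaWitness`,
  `wAll_of_sliceLeaves_x1ShaWitness_primaryGZ` (leaves + cells + SEVENTEEN named facts),
  `wAllFormula_of_sliceLeaves_x1ShaWitness_primaryGZ` (+ one sign binder `hL0`).

References: `WAll/TargetX1Slices.lean` (p507296), `WAll/AltClosersGlueX1Slices.lean` (p509093),
`Literature/…/Rank1Residual/ClassX1Isogeny.lean`, `…/X1RankZeroCertificate.lean`,
`…/Typed/CasselsLowerBound.lean`; [cite: Wuthrich2014, Prop. 21 (p. 400)]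
[cite: SilvermanAEC2009, Thm. X.4.14] [cite: MilneADT2006, Thm. I.7.3]
[cite: Miller2011LMS, Def. 1.1 (arXiv:1010.2431 p. 3)] [cite: Mazur1978, §6 Prop. 6.3 (1) (p. 153)].
-/

noncomputable section

open scoped Classical

open WeierstrassCurve Literature.NumberTheory.EllipticCurves
  Literature.NumberTheory.EllipticCurves.Rank1Residual
  Literature.NumberTheory.EllipticCurves.Rank1Residual.Typed
  Literature.NumberTheory.EllipticCurves.Wuthrich2014
  Literature.NumberTheory.EllipticCurves.ModularForms

set_option autoImplicit false

namespace Summit.BirchSwinnertonDyer.Rank1Residual.WAll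

open Summit.BirchSwinnertonDyer
open Summit.BirchSwinnertonDyer.BirchSwinnertonDyer.Rank1Residual (NonCMAtTwo BSDpOnClassX9)

/-! ## §0 Exactness of the witness cell: `BSD(E,p)` with `p ∣ #Ш_an` hands back a witness -/

/-- **`BSD(E,p)` ⇒ the witness.** If Miller's `BSD(E,p)` holds for `W` and `#Ш(W)_an` is a rational
`q` with `0 < ord_p q`, then `Ш(W)` has a non-zero element killed by `p`: `BSD(E,p)` says
`ord_p q = ord_p #Ш(W)(p)` with `Ш(W)(p)` finite, so `p ∣ #Ш(W)(p)` and Cauchy's theorem gives an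
element of order `p`. (So a witness hypothesis is never stronger than the rung it serves.)
[cite: Miller2011LMS, Def. 1.1 (arXiv:1010.2431 p. 3)] -/
theorem exists_sha_torsion_of_bsdp_of_padicValRat_pos (W : WeierstrassCurve ℚ) [W.IsElliptic]
    (p : ℕ) [Fact p.Prime] (h : BSDp W p) {q : ℚ} (hq : shaAn W = (q : ℂ))
    (hpos : 0 < padicValRat p q) : ∃ x : W.sha, x ≠ 0 ∧ p • x = 0 := by
  obtain ⟨-, hfin, q₀, hq₀, hval⟩ := h
  have hqq : q₀ = q := by exact_mod_cast hq₀.symm.trans hq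
  subst hqq
  haveI := hfin
  have hne : padicValNat p (Nat.card (AddCommGroup.primaryComponent W.sha p)) ≠ 0 := by
    intro h0
    rw [h0] at hval
    simp only [CharP.cast_eq_zero] at hval
    exact hpos.ne' hval
  have hdvd : p ∣ Nat.card (AddCommGroup.primaryComponent W.sha p) := by
    by_contra hnd
    exact hne (padicValNat.eq_zero_of_not_dvd hnd)
  obtain ⟨x, hx⟩ := exists_prime_addOrderOf_dvd_card' (G := AddCommGroup.primaryComponent W.sha p)
    p hdvd
  refine ⟨(x : W.sha), ?_, ?_⟩
  · intro h0
    have h1 : x = 0 := by exact_mod_cast h0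
    rw [h1, addOrderOf_zero] at hx
    exact (Fact.out : p.Prime).one_lt.ne hx
  · have h2 : addOrderOf x • x = 0 := addOrderOf_nsmul_eq_zero x
    rw [hx] at h2
    exact_mod_cast congrArg ((↑) : AddCommGroup.primaryComponent W.sha p → W.sha) h2

/-! ## §1 The rank-`0` X1 leaf from PUB⁵ + the MIN-DIGIT cell + the WITNESS cell -/

/-- **`BSD(E,p)` at every rank-`0` X1 pair from the two certificate cells** (eis g2's
`forall_bsdp_of_stubs` with the published inputs unbundled): locate a member `W'` of the Mazur class
with `0 ≤ ord_p #Ш(W')_an ≤ 2` (`hmin`); at digit `0` the unit lever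
`X1.bsdp_of_shaAn_unit_of_isIsogenous'` (Wuthrich Prop. 21 + Cassels), at digit `1`–`2` the witness
lever `X1.bsdp_of_exists_torsion_of_isIsogenous'` fed by `hwit` (Kato–Wuthrich + Cassels–Tate
squareness + Cassels). CONDITIONAL; nothing closed. [cite: Wuthrich2014, Prop. 21 (p. 400)]
[cite: SilvermanAEC2009, Thm. X.4.14] [cite: MilneADT2006, Thm. I.7.3] -/
theorem x1RankZero_bsdp_of_minDigit_of_witness (hCT : exists_casselsTate_pairing (K := ℚ))
    (hW : sha_dvd_analyticSha) (hGZK : rank_eq_analyticRank_of_analyticRank_le_one)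
    (hmod : hasEntireLFunction_rat) (hCassels : bsdRHS_eq_of_isIsogenous)
    (hmin : ∀ (W : WeierstrassCurve ℚ) [W.IsElliptic] [W.IsGloballyMinimal] (p : ℕ)
      [Fact p.Prime], ClassX1 W p → W.analyticRank = 0 →
      ∃ (W' : WeierstrassCurve ℚ) (_ : W'.IsElliptic) (_ : W'.IsGloballyMinimal), IsIsogenous W W' ∧
        ∃ q : ℚ, shaAn W' = (q : ℂ) ∧ 0 ≤ padicValRat p q ∧ padicValRat p q ≤ 2)
    (hwit : ∀ (W W' : WeierstrassCurve ℚ) [W.IsElliptic] [W.IsGloballyMinimal]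
      [W'.IsElliptic] [W'.IsGloballyMinimal] (p : ℕ) [Fact p.Prime], ClassX1 W p → W.analyticRank = 0 →
      IsIsogenous W W' → ∀ q : ℚ, shaAn W' = (q : ℂ) → 0 < padicValRat p q → padicValRat p q ≤ 2 →
      ∃ x : W'.sha, x ≠ 0 ∧ p • x = 0)
    (W : WeierstrassCurve ℚ) [W.IsElliptic] [W.IsGloballyMinimal] (p : ℕ) [Fact p.Prime]
    (hX : ClassX1 W p) (hr0 : W.analyticRank = 0) : BSDp W p := by
  have hr : W.analyticRank ≤ 1 := by omega
  obtain ⟨W', iE, iM, hiso, q, hq, hv0, hv⟩ := hmin W p hX hr0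
  rcases hv0.eq_or_lt with h0 | hpos
  · exact X1.bsdp_of_shaAn_unit_of_isIsogenous' hW hGZK hmod hCassels W W' hiso p hr hX hr0
      ⟨q, hq, h0.symm⟩
  · exact X1.bsdp_of_exists_torsion_of_isIsogenous' hCT hW hGZK hmod hCassels W W' hiso p hr hX hr0
      hq hv (hwit W W' p hX hr0 hiso q hq hpos hv)

/-- **The rank-`0` X1 leaf statement (ladder row A3, `X1.RankZero.Statement`) ⇐ PUB⁵ + `hmin` +
`hwit`.** CONDITIONAL; nothing closed. [cite: Wuthrich2014, Prop. 21 (p. 400)]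
[cite: SilvermanAEC2009, Thm. X.4.14] [cite: MilneADT2006, Thm. I.7.3] -/
theorem x1RankZeroStatement_of_minDigit_of_witness (hCT : exists_casselsTate_pairing (K := ℚ))
    (hW : sha_dvd_analyticSha) (hGZK : rank_eq_analyticRank_of_analyticRank_le_one)
    (hmod : hasEntireLFunction_rat) (hCassels : bsdRHS_eq_of_isIsogenous)
    (hmin : ∀ (W : WeierstrassCurve ℚ) [W.IsElliptic] [W.IsGloballyMinimal] (p : ℕ)
      [Fact p.Prime], ClassX1 W p → W.analyticRank = 0 →
      ∃ (W' : WeierstrassCurve ℚ) (_ : W'.IsElliptic) (_ : W'.IsGloballyMinimal), IsIsogenous W W' ∧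
        ∃ q : ℚ, shaAn W' = (q : ℂ) ∧ 0 ≤ padicValRat p q ∧ padicValRat p q ≤ 2)
    (hwit : ∀ (W W' : WeierstrassCurve ℚ) [W.IsElliptic] [W.IsGloballyMinimal]
      [W'.IsElliptic] [W'.IsGloballyMinimal] (p : ℕ) [Fact p.Prime], ClassX1 W p → W.analyticRank = 0 →
      IsIsogenous W W' → ∀ q : ℚ, shaAn W' = (q : ℂ) → 0 < padicValRat p q → padicValRat p q ≤ 2 →
      ∃ x : W'.sha, x ≠ 0 ∧ p • x = 0) :
    X1.RankZero.Statement :=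
  fun W _ _ p _ hL ↦ x1RankZero_bsdp_of_minDigit_of_witness hCT hW hGZK hmod hCassels hmin hwit W p
    hL.1 hL.2

/-- **Both rank-`0` slices of row 4** (`WAllCornerX1RankZeroBalanced ∧ WAllCornerX1RankZeroUnbalanced`,
`TargetX1Slices`) ⇐ PUB⁵ + `hmin` + `hwit` (`x1RankZeroStatement_iff_balanced_unbalanced`).
CONDITIONAL; nothing closed. [cite: Wuthrich2014, Prop. 21 (p. 400)] -/
theorem x1RankZeroSlices_of_minDigit_of_witness (hCT : exists_casselsTate_pairing (K := ℚ))
    (hW : sha_dvd_analyticSha) (hGZK : rank_eq_analyticRank_of_analyticRank_le_one)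
    (hmod : hasEntireLFunction_rat) (hCassels : bsdRHS_eq_of_isIsogenous)
    (hmin : ∀ (W : WeierstrassCurve ℚ) [W.IsElliptic] [W.IsGloballyMinimal] (p : ℕ)
      [Fact p.Prime], ClassX1 W p → W.analyticRank = 0 →
      ∃ (W' : WeierstrassCurve ℚ) (_ : W'.IsElliptic) (_ : W'.IsGloballyMinimal), IsIsogenous W W' ∧
        ∃ q : ℚ, shaAn W' = (q : ℂ) ∧ 0 ≤ padicValRat p q ∧ padicValRat p q ≤ 2)
    (hwit : ∀ (W W' : WeierstrassCurve ℚ) [W.IsElliptic] [W.IsGloballyMinimal]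
      [W'.IsElliptic] [W'.IsGloballyMinimal] (p : ℕ) [Fact p.Prime], ClassX1 W p → W.analyticRank = 0 →
      IsIsogenous W W' → ∀ q : ℚ, shaAn W' = (q : ℂ) → 0 < padicValRat p q → padicValRat p q ≤ 2 →
      ∃ x : W'.sha, x ≠ 0 ∧ p • x = 0) :
    WAllCornerX1RankZeroBalanced ∧ WAllCornerX1RankZeroUnbalanced :=
  x1RankZeroStatement_iff_balanced_unbalanced.mp
    (x1RankZeroStatement_of_minDigit_of_witness hCT hW hGZK hmod hCassels hmin hwit)

/-! ## §2 The UNBALANCED slice from the cells restricted to the unbalanced locus -/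

/-- **The unbalanced rank-`0` slice `WAllCornerX1RankZeroUnbalanced` ⇐ PUB⁵ + the MIN-DIGIT and
WITNESS cells RESTRICTED to unbalanced leaf pairs** (no squarefree-conductor member with rational
`p`-torsion and `ord_p ∏ c_ℓ = 1`; the balance predicate is the slice's, verbatim). The A3 residue of
record is 149/149 eligible for this road (123 classes through the rational `3`-isogeny, 26 twisted
type A; 146 @3 + 3 @5 — eis g2 X1-19035-PRICING-v1 (c)). CONDITIONAL; nothing closed.
[cite: Wuthrich2014, Prop. 21 (p. 400)] [cite: SilvermanAEC2009, Thm. X.4.14]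
[cite: MilneADT2006, Thm. I.7.3] -/
theorem wAllCornerX1RankZeroUnbalanced_of_minDigitU_of_witnessU
    (hCT : exists_casselsTate_pairing (K := ℚ))
    (hW : sha_dvd_analyticSha) (hGZK : rank_eq_analyticRank_of_analyticRank_le_one)
    (hmod : hasEntireLFunction_rat) (hCassels : bsdRHS_eq_of_isIsogenous)
    (hminU : ∀ (W : WeierstrassCurve ℚ) [W.IsElliptic] [W.IsGloballyMinimal] (p : ℕ)
      [Fact p.Prime], X1.RankZero.Leaf W p →
      ¬ (Squarefree (W.conductorNorm ℤ) ∧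
        ∃ (W' : WeierstrassCurve ℚ) (_ : W'.IsElliptic) (_ : W'.IsGloballyMinimal),
          IsIsogenous W W' ∧ p ∣ W'.torsionOrder ∧ padicValNat p W'.tamagawaProduct = 1) →
      ∃ (W' : WeierstrassCurve ℚ) (_ : W'.IsElliptic) (_ : W'.IsGloballyMinimal), IsIsogenous W W' ∧
        ∃ q : ℚ, shaAn W' = (q : ℂ) ∧ 0 ≤ padicValRat p q ∧ padicValRat p q ≤ 2)
    (hwitU : ∀ (W W' : WeierstrassCurve ℚ) [W.IsElliptic] [W.IsGloballyMinimal]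
      [W'.IsElliptic] [W'.IsGloballyMinimal] (p : ℕ) [Fact p.Prime], X1.RankZero.Leaf W p →
      ¬ (Squarefree (W.conductorNorm ℤ) ∧
        ∃ (W' : WeierstrassCurve ℚ) (_ : W'.IsElliptic) (_ : W'.IsGloballyMinimal),
          IsIsogenous W W' ∧ p ∣ W'.torsionOrder ∧ padicValNat p W'.tamagawaProduct = 1) →
      IsIsogenous W W' → ∀ q : ℚ, shaAn W' = (q : ℂ) → 0 < padicValRat p q → padicValRat p q ≤ 2 →
      ∃ x : W'.sha, x ≠ 0 ∧ p • x = 0) :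
    WAllCornerX1RankZeroUnbalanced := by
  intro W _ _ p _ hL hU
  have hr : W.analyticRank ≤ 1 := by have h0 := hL.2; omega
  obtain ⟨W', iE, iM, hiso, q, hq, hv0, hv⟩ := hminU W p hL hU
  rcases hv0.eq_or_lt with h0 | hpos
  · exact X1.bsdp_of_shaAn_unit_of_isIsogenous' hW hGZK hmod hCassels W W' hiso p hr hL.1 hL.2
      ⟨q, hq, h0.symm⟩
  · exact X1.bsdp_of_exists_torsion_of_isIsogenous' hCT hW hGZK hmod hCassels W W' hiso p hr hL.1
      hL.2 hq hv (hwitU W W' p hL hU hiso q hq hpos hv)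

/-! ## §3 Exactness of the witness cell -/

/-- **The WITNESS cell follows from the rank-`0` leaf statement** (so it is residue-exact, never
stronger than row 4): an isogenous `W'` of a rank-`0` X1 pair is itself a rank-`0` X1 pair
(`ClassX1.of_isIsogenous`, equal analytic ranks — Knapp Thm. 11.67), so `X1.RankZero.Statement`
gives `BSD(W',p)`, and §0 turns `0 < ord_p #Ш(W')_an` into a witness. [cite: Knapp1993, Thm. 11.67 (PDF p. 281)]
[cite: Miller2011LMS, Def. 1.1 (arXiv:1010.2431 p. 3)] -/
theorem witness_of_x1RankZeroStatement (hS : X1.RankZero.Statement) :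
    ∀ (W W' : WeierstrassCurve ℚ) [W.IsElliptic] [W.IsGloballyMinimal]
      [W'.IsElliptic] [W'.IsGloballyMinimal] (p : ℕ) [Fact p.Prime], ClassX1 W p → W.analyticRank = 0 →
      IsIsogenous W W' → ∀ q : ℚ, shaAn W' = (q : ℂ) → 0 < padicValRat p q → padicValRat p q ≤ 2 →
      ∃ x : W'.sha, x ≠ 0 ∧ p • x = 0 := by
  intro W W' _ _ _ _ p _ hX hr0 hiso q hq hpos _
  have hX' : ClassX1 W' p := ClassX1.of_isIsogenous hiso hX
  have hr0' : W'.analyticRank = 0 := (analyticRank_eq_of_isIsogenous' hiso) ▸ hr0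
  exact exists_sha_torsion_of_bsdp_of_padicValRat_pos W' p (hS W' p ⟨hX', hr0'⟩) hq hpos

/-- **… and from `WAll`** (row 4 rank `0` is a slice of W-ALL). [cite: Miller2011LMS, Def. 1.1 (arXiv:1010.2431 p. 3)] -/
theorem witness_of_wAll (h : WAll) :
    ∀ (W W' : WeierstrassCurve ℚ) [W.IsElliptic] [W.IsGloballyMinimal]
      [W'.IsElliptic] [W'.IsGloballyMinimal] (p : ℕ) [Fact p.Prime], ClassX1 W p → W.analyticRank = 0 →
      IsIsogenous W W' → ∀ q : ℚ, shaAn W' = (q : ℂ) → 0 < padicValRat p q → padicValRat p q ≤ 2 →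
      ∃ x : W'.sha, x ≠ 0 ∧ p • x = 0 :=
  witness_of_x1RankZeroStatement fun W _ _ p _ hL ↦ h W p (by have h0 := hL.2; omega)

/-! ## §4 Row 4 and the registry with row 4 rank `0` in Ш-witness currency -/

/-- **Row 4 (`WAllCornerX1`) ⇐ PUB⁵ + `hmin` + `hwit` + the rank-`1` leaf statement**
(`wallCornerX1_of_x1Statements`; a class-X1 pair is non-CM). CONDITIONAL; nothing closed.
[cite: Mazur1978, §6 Prop. 6.3 (1) (p. 153)] [cite: Wuthrich2014, Prop. 21 (p. 400)] -/
theorem wAllCornerX1_of_minDigit_of_witness_of_x1RankOne (hCT : exists_casselsTate_pairing (K := ℚ))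
    (hW : sha_dvd_analyticSha) (hGZK : rank_eq_analyticRank_of_analyticRank_le_one)
    (hmod : hasEntireLFunction_rat) (hCassels : bsdRHS_eq_of_isIsogenous)
    (hmin : ∀ (W : WeierstrassCurve ℚ) [W.IsElliptic] [W.IsGloballyMinimal] (p : ℕ)
      [Fact p.Prime], ClassX1 W p → W.analyticRank = 0 →
      ∃ (W' : WeierstrassCurve ℚ) (_ : W'.IsElliptic) (_ : W'.IsGloballyMinimal), IsIsogenous W W' ∧
        ∃ q : ℚ, shaAn W' = (q : ℂ) ∧ 0 ≤ padicValRat p q ∧ padicValRat p q ≤ 2)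
    (hwit : ∀ (W W' : WeierstrassCurve ℚ) [W.IsElliptic] [W.IsGloballyMinimal]
      [W'.IsElliptic] [W'.IsGloballyMinimal] (p : ℕ) [Fact p.Prime], ClassX1 W p → W.analyticRank = 0 →
      IsIsogenous W W' → ∀ q : ℚ, shaAn W' = (q : ℂ) → 0 < padicValRat p q → padicValRat p q ≤ 2 →
      ∃ x : W'.sha, x ≠ 0 ∧ p • x = 0)
    (h1 : X1.RankOne.Statement) : WAllCornerX1 :=
  wallCornerX1_of_x1Statements
    (x1RankZeroStatement_of_minDigit_of_witness hCT hW hGZK hmod hCassels hmin hwit) h1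

/-- **THE CLOSED LIST with row 4 rank `0` in Ш-witness currency**: as
`wAllExclusions_of_sliceLeaves_x1Slices` with the two rank-`0` X1 slices replaced by `hCT`,
`hCassels`, `hmin`, `hwit` (`hW`, `hmod`, `hGZK` are already registry inputs). [folklore] -/
theorem wAllExclusions_of_sliceLeaves_x1ShaWitness (h5 : NonCMAtTwo)
    (h30 : WAllExclAdditiveAtThreeRankZero) (h31 : WAllExclAdditiveAtThreeRankOne)
    (h50 : WAllExclAdditiveFiveLeRankZero) (h51 : WAllExclAdditiveFiveLeRankOne)
    (hK2a : X11b.MultiplicativeRankOne) (hK2b : X11b.MultiplicativeRankOneAtThree)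
    (hCT : exists_casselsTate_pairing (K := ℚ)) (hCassels : bsdRHS_eq_of_isIsogenous)
    (hmin : ∀ (W : WeierstrassCurve ℚ) [W.IsElliptic] [W.IsGloballyMinimal] (p : ℕ)
      [Fact p.Prime], ClassX1 W p → W.analyticRank = 0 →
      ∃ (W' : WeierstrassCurve ℚ) (_ : W'.IsElliptic) (_ : W'.IsGloballyMinimal), IsIsogenous W W' ∧
        ∃ q : ℚ, shaAn W' = (q : ℂ) ∧ 0 ≤ padicValRat p q ∧ padicValRat p q ≤ 2)
    (hwit : ∀ (W W' : WeierstrassCurve ℚ) [W.IsElliptic] [W.IsGloballyMinimal]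
      [W'.IsElliptic] [W'.IsGloballyMinimal] (p : ℕ) [Fact p.Prime], ClassX1 W p → W.analyticRank = 0 →
      IsIsogenous W W' → ∀ q : ℚ, shaAn W' = (q : ℂ) → 0 < padicValRat p q → padicValRat p q ≤ 2 →
      ∃ x : W'.sha, x ≠ 0 ∧ p • x = 0)
    (hX1R1 : X1.RankOne.Statement) (hX2 : X2.Target)
    (hK3 : Supersingular.SignedSupersingular)
    (h73 : WAllCornerX7AtThree) (h75 : WAllCornerX7FiveLe)
    (hK6 : BSDpOnClassX9) (hX10b : X10.BSDpOnClassX10b) (hX11a : X11a.Target)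
    (hF3 : WAllCornerFInertBadAtThree) (hF5 : WAllCornerFInertBadFiveLe)
    (hF2 : WAllCornerFTwo) (hFr : WAllCornerFRamified)
    (hW : sha_dvd_analyticSha) (hmod : hasEntireLFunction_rat)
    (hGZK : rank_eq_analyticRank_of_analyticRank_le_one) : WAllExclusions := by
  obtain ⟨hB, hU⟩ := x1RankZeroSlices_of_minDigit_of_witness hCT hW hGZK hmod hCassels hmin hwit
  exact wAllExclusions_of_sliceLeaves_x1Slices h5 h30 h31 h50 h51 hK2a hK2b hB hU hX1R1 hX2 hK3 h73 h75
    hK6 hX10b hX11a hF3 hF5 hF2 hFr hW hmod hGZK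

/-- **W-ALL with row 4 rank `0` in Ш-witness currency, SEVENTEEN named facts, the Gross–Zagier side
primary** (`wAll_of_exclusions_primaryGZ ∘ wAllExclusions_of_sliceLeaves_x1ShaWitness`; `hmod`
derived from `hmodP`, `hGZK` fed from its road of record). No preprint input on row 4 rank `0`.
[cite: Darmon2004, Thm. 3.22 and §3.9] [cite: Wuthrich2014, Prop. 21 (p. 400)] -/
theorem wAll_of_sliceLeaves_x1ShaWitness_primaryGZ (h5 : NonCMAtTwo)
    (h30 : WAllExclAdditiveAtThreeRankZero) (h31 : WAllExclAdditiveAtThreeRankOne)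
    (h50 : WAllExclAdditiveFiveLeRankZero) (h51 : WAllExclAdditiveFiveLeRankOne)
    (hK2a : X11b.MultiplicativeRankOne) (hK2b : X11b.MultiplicativeRankOneAtThree)
    (hCT : exists_casselsTate_pairing (K := ℚ)) (hCassels : bsdRHS_eq_of_isIsogenous)
    (hmin : ∀ (W : WeierstrassCurve ℚ) [W.IsElliptic] [W.IsGloballyMinimal] (p : ℕ)
      [Fact p.Prime], ClassX1 W p → W.analyticRank = 0 →
      ∃ (W' : WeierstrassCurve ℚ) (_ : W'.IsElliptic) (_ : W'.IsGloballyMinimal), IsIsogenous W W' ∧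
        ∃ q : ℚ, shaAn W' = (q : ℂ) ∧ 0 ≤ padicValRat p q ∧ padicValRat p q ≤ 2)
    (hwit : ∀ (W W' : WeierstrassCurve ℚ) [W.IsElliptic] [W.IsGloballyMinimal]
      [W'.IsElliptic] [W'.IsGloballyMinimal] (p : ℕ) [Fact p.Prime], ClassX1 W p → W.analyticRank = 0 →
      IsIsogenous W W' → ∀ q : ℚ, shaAn W' = (q : ℂ) → 0 < padicValRat p q → padicValRat p q ≤ 2 →
      ∃ x : W'.sha, x ≠ 0 ∧ p • x = 0)
    (hX1R1 : X1.RankOne.Statement) (hX2 : X2.Target)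
    (hK3 : Supersingular.SignedSupersingular)
    (h73 : WAllCornerX7AtThree) (h75 : WAllCornerX7FiveLe)
    (hK6 : BSDpOnClassX9) (hX10b : X10.BSDpOnClassX10b) (hX11a : X11a.Target)
    (hF3 : WAllCornerFInertBadAtThree) (hF5 : WAllCornerFInertBadFiveLe)
    (hF2 : WAllCornerFTwo) (hFr : WAllCornerFRamified)
    (hW : sha_dvd_analyticSha)
    (hSk : Skinner2016.thmC_padicValRat_bsd_rank_zero)
    (hBCS : BurungaleCastellaSkinner2025.cor131_padicValRat_bsd_rank_le_one)
    (hJSW : JetchevSkinnerWan2017.thm121_padicValRat_bsd_rank_one)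
    (hCGS : CastellaGrossiSkinner2025.thmD_padicValRat_bsd_rank_le_one)
    (hGV : GreenbergVatsal2000.thm13_charIdeal_eq_of_gvPar) (hGr : greenberg_charValue_rankZero)
    (hmodP : nonempty_modularParametrizationData)
    (hWa : waldspurger_exists_heegnerField_twist_ne_zero)
    (hMM : murtyMurty_exists_heegnerField_twist_simpleZero)
    (hGZ : ∀ (N : ℕ) [NeZero N] (W : WeierstrassCurve ℚ) (K : Type) [Field K] [NumberField K],
      gross_zagier N W K)
    (hKo : ∀ (N : ℕ) [NeZero N] (W : WeierstrassCurve ℚ) (K : Type) [Field K] [NumberField K],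
      kolyvagin N W K)
    (hCM : bsdTriple_of_hasCM_of_L_one_ne_zero) (hKob : Kobayashi2013.cor14_bsdp_of_cm_rank_one)
    (hYZ : YanZhu2026.thm415_padicValRat_bsd_rank_le_one)
    (hLLT : LiLiuTian2024.thm11_bsdp_of_cm_rank_one) : WAll :=
  have hmod : hasEntireLFunction_rat :=
    X2.ClassClosureEntireFree.hasEntireLFunction_rat_of_nonempty_modularParametrizationData hmodP
  have hGZK : rank_eq_analyticRank_of_analyticRank_le_one :=
    rank_eq_analyticRank_of_analyticRank_le_one_of_nonempty_modularParametrizationData hmodP hWa hMM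
      hGZ hKo
  wAll_of_exclusions_primaryGZ
    (wAllExclusions_of_sliceLeaves_x1ShaWitness h5 h30 h31 h50 h51 hK2a hK2b hCT hCassels hmin hwit
      hX1R1 hX2 hK3 h73 h75 hK6 hX10b hX11a hF3 hF5 hF2 hFr hW hmod hGZK)
    hSk hBCS hJSW hCGS hGV hGr hmodP hWa hMM hGZ hKo hCM hKob hYZ hLLT

/-- **THE FULL BSD FORMULA FOR EVERY `E/ℚ` OF ANALYTIC RANK `≤ 1`** with row 4 rank `0` in
Ш-witness currency: SEVENTEEN named facts and ONE sign binder `hL0`.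
[cite: GrossZagier1986, Thm. V.(2.1) (p. 311) and V.§2 (pp. 312–313)]
[cite: Darmon2004, Thm. 3.22 and §3.9] -/
theorem wAllFormula_of_sliceLeaves_x1ShaWitness_primaryGZ (h5 : NonCMAtTwo)
    (h30 : WAllExclAdditiveAtThreeRankZero) (h31 : WAllExclAdditiveAtThreeRankOne)
    (h50 : WAllExclAdditiveFiveLeRankZero) (h51 : WAllExclAdditiveFiveLeRankOne)
    (hK2a : X11b.MultiplicativeRankOne) (hK2b : X11b.MultiplicativeRankOneAtThree)
    (hCT : exists_casselsTate_pairing (K := ℚ)) (hCassels : bsdRHS_eq_of_isIsogenous)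
    (hmin : ∀ (W : WeierstrassCurve ℚ) [W.IsElliptic] [W.IsGloballyMinimal] (p : ℕ)
      [Fact p.Prime], ClassX1 W p → W.analyticRank = 0 →
      ∃ (W' : WeierstrassCurve ℚ) (_ : W'.IsElliptic) (_ : W'.IsGloballyMinimal), IsIsogenous W W' ∧
        ∃ q : ℚ, shaAn W' = (q : ℂ) ∧ 0 ≤ padicValRat p q ∧ padicValRat p q ≤ 2)
    (hwit : ∀ (W W' : WeierstrassCurve ℚ) [W.IsElliptic] [W.IsGloballyMinimal]
      [W'.IsElliptic] [W'.IsGloballyMinimal] (p : ℕ) [Fact p.Prime], ClassX1 W p → W.analyticRank = 0 →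
      IsIsogenous W W' → ∀ q : ℚ, shaAn W' = (q : ℂ) → 0 < padicValRat p q → padicValRat p q ≤ 2 →
      ∃ x : W'.sha, x ≠ 0 ∧ p • x = 0)
    (hX1R1 : X1.RankOne.Statement) (hX2 : X2.Target)
    (hK3 : Supersingular.SignedSupersingular)
    (h73 : WAllCornerX7AtThree) (h75 : WAllCornerX7FiveLe)
    (hK6 : BSDpOnClassX9) (hX10b : X10.BSDpOnClassX10b) (hX11a : X11a.Target)
    (hF3 : WAllCornerFInertBadAtThree) (hF5 : WAllCornerFInertBadFiveLe)
    (hF2 : WAllCornerFTwo) (hFr : WAllCornerFRamified)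
    (hW : sha_dvd_analyticSha)
    (hSk : Skinner2016.thmC_padicValRat_bsd_rank_zero)
    (hBCS : BurungaleCastellaSkinner2025.cor131_padicValRat_bsd_rank_le_one)
    (hJSW : JetchevSkinnerWan2017.thm121_padicValRat_bsd_rank_one)
    (hCGS : CastellaGrossiSkinner2025.thmD_padicValRat_bsd_rank_le_one)
    (hGV : GreenbergVatsal2000.thm13_charIdeal_eq_of_gvPar) (hGr : greenberg_charValue_rankZero)
    (hmodP : nonempty_modularParametrizationData)
    (hWa : waldspurger_exists_heegnerField_twist_ne_zero)
    (hMM : murtyMurty_exists_heegnerField_twist_simpleZero)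
    (hGZ : ∀ (N : ℕ) [NeZero N] (W : WeierstrassCurve ℚ) (K : Type) [Field K] [NumberField K],
      gross_zagier N W K)
    (hKo : ∀ (N : ℕ) [NeZero N] (W : WeierstrassCurve ℚ) (K : Type) [Field K] [NumberField K],
      kolyvagin N W K)
    (hCM : bsdTriple_of_hasCM_of_L_one_ne_zero) (hKob : Kobayashi2013.cor14_bsdp_of_cm_rank_one)
    (hYZ : YanZhu2026.thm415_padicValRat_bsd_rank_le_one)
    (hLLT : LiLiuTian2024.thm11_bsdp_of_cm_rank_one)
    (hL0 : re_entireLFunction_one_nonneg) : WAllFormula :=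
  wAllFormula_of_wAll_oneSign hmodP hL0 hWa hGZ
    (wAll_of_sliceLeaves_x1ShaWitness_primaryGZ h5 h30 h31 h50 h51 hK2a hK2b hCT hCassels hmin hwit
      hX1R1 hX2 hK3 h73 h75 hK6 hX10b hX11a hF3 hF5 hF2 hFr hW hSk hBCS hJSW hCGS hGV hGr hmodP hWa hMM
      hGZ hKo hCM hKob hYZ hLLT)

end Summit.BirchSwinnertonDyer.Rank1Residual.WAll

end
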